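import Summits.Ventures.WeilGRH.UniformConductorFloorCoprimeSound
import Summits.Ventures.WeilGRH.UniformConductorFloorCoprimeEvenTwoLog8Check
import Summits.Ventures.WeilGRH.UniformConductorFloorCoprimeOddTwoLog8Check
import Summits.Ventures.WeilGRH.UniformConductorFloorCoprimeEvenThreeLog8Check
import Summits.Ventures.WeilGRH.UniformConductorFloorCoprimeOddThreeLog8Check
import Summits.Ventures.WeilGRH.UniformConductorFloorCoprimeEvenSixLog8Check
import Summits.Ventures.WeilGRH.UniformConductorFloorCoprimeOddSixLog8Check
import Summits.Ventures.WeilGRH.UniformConductorFloorCoprimeInputsLog8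
import HarnessLib

/-!
# GRH arm (rh-explicit, venture WeilGRH): ★ DIVISIBILITY FLOORS at the rung `t = (log 8)/2` — Weil positivity on `[-(log 8)/2, (log 8)/2]` for EVERY
  Dirichlet character of EVERY modulus `q` with `m ∣ q`, `q ≥ q*((log 8)/2; m)`, `m ∈ {2, 3, 6}`

Cell `rh-explicit`, WEIL TRACK — GRH ARM (weil-grh-1, gen7).  The level-`m` joint cell certificates of
`UniformConductorFloorCoprimeDataLog8.lean` (grid `R = 320`, `J = 333`, window `333 log(320/319) = 1.04225 ≥ (log 8)/2`; kernel checks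
`…Coprime{Even,Odd}{Two,Three,Six}Log8Check.lean`; inputs `…CoprimeInputsLog8.lean`) through `JointCert.weilPositivityOnChar_of_le_of_parts_coprime`:

| `m` | all `χ`: stated floor | odd `χ` |
|---|---|---|
| 1 (tree, `…JointFloorsLog8`) | 97 | 37 |
| 2 | 42 (budget 3.6839, e^· = 39.80) | 16 (2.7341, 15.40) |
| 3 | 54 (budget 3.9630, e^· = 52.61) | 21 (3.0054, 20.19) |
| 6 | 24 (budget 3.0779, e^· = 21.71) | 12 (2.1377, 8.48) |

(stated floor = the first multiple of `m` above the method floor `e^budget` whose logarithm has a two-term lower bound in `log 2`, `log 3`.)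
Honest scope: finite-window statements; nothing here is a step towards GRH for any individual character; no `ζ` input; standard axioms.

## References

* A. Weil (1952), (11) pp. 261–262 and the «lemme» p. 262 [Weil1952FormulesExplicites]; L. Collatz (1942) / H. Wielandt (1950). [folklore]
-/

noncomputable section

open Real Set
open scoped ArithmeticFunction.vonMangoldt

namespace Summit.Ventures.WeilGRH

open Literature.NumberTheory.LFunctions

namespace UniformFloor

variable {q : ℕ}

/-- ★ Every EVEN character of every modulus `q ≥ 42` with `2 ∣ q` at the rung `(log 8)/2`. [folklore] -/
theorem weilPositivityOnChar_log8half_of_even_two_dvd_ge_42 (hm : 2 ∣ q) (hq : 42 ≤ q) (χ : DirichletCharacter ℂ q)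
    (hpar : charParity χ = 0) : WeilPositivityOnChar χ (Real.log 8 / 2) :=
  certEvenDvd2Log8.weilPositivityOnChar_of_le_of_parts_coprime certEvenDvd2Log8_checkFrame
    (fun _ hj ↦ certEvenDvd2Log8.cellOKB_of_checkCells certEvenDvd2Log8_checkCells hj) certEvenDvd2Log8_hw psi_even_ge
    (Q₀ := 42) (by norm_num) certEvenDvd2Log8_budget (by omega) hm hq χ hpar (log8half_le_t certEvenDvd2Log8 rfl rfl)

/-- ★ Every ODD character of every modulus `q ≥ 16` with `2 ∣ q` at the rung `(log 8)/2`. [cite: Weil1952FormulesExplicites, (11) and the «lemme» p. 262] -/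
theorem weilPositivityOnChar_log8half_of_odd_two_dvd_ge_16 (hm : 2 ∣ q) (hq : 16 ≤ q) (χ : DirichletCharacter ℂ q)
    (hpar : charParity χ = 1) : WeilPositivityOnChar χ (Real.log 8 / 2) :=
  certOddDvd2Log8.weilPositivityOnChar_of_le_of_parts_coprime certOddDvd2Log8_checkFrame
    (fun _ hj ↦ certOddDvd2Log8.cellOKB_of_checkCells certOddDvd2Log8_checkCells hj) certOddDvd2Log8_hw psi_odd_ge
    (Q₀ := 16) (by norm_num) certOddDvd2Log8_budget (by omega) hm hq χ hpar (log8half_le_t certOddDvd2Log8 rfl rfl)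

/-- ★★ EVERY Dirichlet character of EVERY modulus `q ≥ 42` with `2 ∣ q` satisfies `WeilPositivityOnChar χ ((log 8)/2)`.
[cite: Weil1952FormulesExplicites, (11) and the «lemme» p. 262] -/
theorem weilPositivityOnChar_log8half_of_two_dvd_ge_42 (hm : 2 ∣ q) (hq : 42 ≤ q) (χ : DirichletCharacter ℂ q) :
    WeilPositivityOnChar χ (Real.log 8 / 2) := by
  rcases Nat.le_one_iff_eq_zero_or_eq_one.1 (charParity_le_one χ) with h | h
  · exact weilPositivityOnChar_log8half_of_even_two_dvd_ge_42 hm hq χ h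
  · exact weilPositivityOnChar_log8half_of_odd_two_dvd_ge_16 hm (by omega) χ h

/-- The same on every window `t ≤ (log 8)/2`. [folklore] -/
theorem weilPositivityOnChar_of_le_log8half_of_two_dvd_ge_42 (hm : 2 ∣ q) (hq : 42 ≤ q) (χ : DirichletCharacter ℂ q)
    {t : ℝ} (ht : t ≤ Real.log 8 / 2) : WeilPositivityOnChar χ t := fun g hg hsupp ↦
  weilPositivityOnChar_log8half_of_two_dvd_ge_42 hm hq χ g hg (hsupp.trans (Icc_subset_Icc (by linarith) ht))

/-- ★ Every EVEN character of every modulus `q ≥ 54` with `3 ∣ q` at the rung `(log 8)/2`. [folklore] -/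
theorem weilPositivityOnChar_log8half_of_even_three_dvd_ge_54 (hm : 3 ∣ q) (hq : 54 ≤ q) (χ : DirichletCharacter ℂ q)
    (hpar : charParity χ = 0) : WeilPositivityOnChar χ (Real.log 8 / 2) :=
  certEvenDvd3Log8.weilPositivityOnChar_of_le_of_parts_coprime certEvenDvd3Log8_checkFrame
    (fun _ hj ↦ certEvenDvd3Log8.cellOKB_of_checkCells certEvenDvd3Log8_checkCells hj) certEvenDvd3Log8_hw psi_even_ge
    (Q₀ := 54) (by norm_num) certEvenDvd3Log8_budget (by omega) hm hq χ hpar (log8half_le_t certEvenDvd3Log8 rfl rfl)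

/-- ★ Every ODD character of every modulus `q ≥ 21` with `3 ∣ q` at the rung `(log 8)/2`. [cite: Weil1952FormulesExplicites, (11) and the «lemme» p. 262] -/
theorem weilPositivityOnChar_log8half_of_odd_three_dvd_ge_21 (hm : 3 ∣ q) (hq : 21 ≤ q) (χ : DirichletCharacter ℂ q)
    (hpar : charParity χ = 1) : WeilPositivityOnChar χ (Real.log 8 / 2) :=
  certOddDvd3Log8.weilPositivityOnChar_of_le_of_parts_coprime certOddDvd3Log8_checkFrame
    (fun _ hj ↦ certOddDvd3Log8.cellOKB_of_checkCells certOddDvd3Log8_checkCells hj) certOddDvd3Log8_hw psi_odd_ge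
    (Q₀ := 21) (by norm_num) certOddDvd3Log8_budget (by omega) hm hq χ hpar (log8half_le_t certOddDvd3Log8 rfl rfl)

/-- ★★ EVERY Dirichlet character of EVERY modulus `q ≥ 54` with `3 ∣ q` satisfies `WeilPositivityOnChar χ ((log 8)/2)`.
[cite: Weil1952FormulesExplicites, (11) and the «lemme» p. 262] -/
theorem weilPositivityOnChar_log8half_of_three_dvd_ge_54 (hm : 3 ∣ q) (hq : 54 ≤ q) (χ : DirichletCharacter ℂ q) :
    WeilPositivityOnChar χ (Real.log 8 / 2) := by
  rcases Nat.le_one_iff_eq_zero_or_eq_one.1 (charParity_le_one χ) with h | h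
  · exact weilPositivityOnChar_log8half_of_even_three_dvd_ge_54 hm hq χ h
  · exact weilPositivityOnChar_log8half_of_odd_three_dvd_ge_21 hm (by omega) χ h

/-- The same on every window `t ≤ (log 8)/2`. [folklore] -/
theorem weilPositivityOnChar_of_le_log8half_of_three_dvd_ge_54 (hm : 3 ∣ q) (hq : 54 ≤ q) (χ : DirichletCharacter ℂ q)
    {t : ℝ} (ht : t ≤ Real.log 8 / 2) : WeilPositivityOnChar χ t := fun g hg hsupp ↦
  weilPositivityOnChar_log8half_of_three_dvd_ge_54 hm hq χ g hg (hsupp.trans (Icc_subset_Icc (by linarith) ht))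

/-- ★ Every EVEN character of every modulus `q ≥ 24` with `6 ∣ q` at the rung `(log 8)/2`. [folklore] -/
theorem weilPositivityOnChar_log8half_of_even_six_dvd_ge_24 (hm : 6 ∣ q) (hq : 24 ≤ q) (χ : DirichletCharacter ℂ q)
    (hpar : charParity χ = 0) : WeilPositivityOnChar χ (Real.log 8 / 2) :=
  certEvenDvd6Log8.weilPositivityOnChar_of_le_of_parts_coprime certEvenDvd6Log8_checkFrame
    (fun _ hj ↦ certEvenDvd6Log8.cellOKB_of_checkCells certEvenDvd6Log8_checkCells hj) certEvenDvd6Log8_hw psi_even_ge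
    (Q₀ := 24) (by norm_num) certEvenDvd6Log8_budget (by omega) hm hq χ hpar (log8half_le_t certEvenDvd6Log8 rfl rfl)

/-- ★ Every ODD character of every modulus `q ≥ 12` with `6 ∣ q` at the rung `(log 8)/2`. [cite: Weil1952FormulesExplicites, (11) and the «lemme» p. 262] -/
theorem weilPositivityOnChar_log8half_of_odd_six_dvd_ge_12 (hm : 6 ∣ q) (hq : 12 ≤ q) (χ : DirichletCharacter ℂ q)
    (hpar : charParity χ = 1) : WeilPositivityOnChar χ (Real.log 8 / 2) :=
  certOddDvd6Log8.weilPositivityOnChar_of_le_of_parts_coprime certOddDvd6Log8_checkFrame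
    (fun _ hj ↦ certOddDvd6Log8.cellOKB_of_checkCells certOddDvd6Log8_checkCells hj) certOddDvd6Log8_hw psi_odd_ge
    (Q₀ := 12) (by norm_num) certOddDvd6Log8_budget (by omega) hm hq χ hpar (log8half_le_t certOddDvd6Log8 rfl rfl)

/-- ★★ EVERY Dirichlet character of EVERY modulus `q ≥ 24` with `6 ∣ q` satisfies `WeilPositivityOnChar χ ((log 8)/2)`.
[cite: Weil1952FormulesExplicites, (11) and the «lemme» p. 262] -/
theorem weilPositivityOnChar_log8half_of_six_dvd_ge_24 (hm : 6 ∣ q) (hq : 24 ≤ q) (χ : DirichletCharacter ℂ q) :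
    WeilPositivityOnChar χ (Real.log 8 / 2) := by
  rcases Nat.le_one_iff_eq_zero_or_eq_one.1 (charParity_le_one χ) with h | h
  · exact weilPositivityOnChar_log8half_of_even_six_dvd_ge_24 hm hq χ h
  · exact weilPositivityOnChar_log8half_of_odd_six_dvd_ge_12 hm (by omega) χ h

/-- The same on every window `t ≤ (log 8)/2`. [folklore] -/
theorem weilPositivityOnChar_of_le_log8half_of_six_dvd_ge_24 (hm : 6 ∣ q) (hq : 24 ≤ q) (χ : DirichletCharacter ℂ q)
    {t : ℝ} (ht : t ≤ Real.log 8 / 2) : WeilPositivityOnChar χ t := fun g hg hsupp ↦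
  weilPositivityOnChar_log8half_of_six_dvd_ge_24 hm hq χ g hg (hsupp.trans (Icc_subset_Icc (by linarith) ht))

end UniformFloor

end Summit.Ventures.WeilGRH

end
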